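import Summits.AtomisticToContinuum.Crystallization.Theorems.HullExactificationCascadeZeroDefectDensityAsmFrame
import Literature.Geometry.DiscreteGeometry.KissingRigidity
import HarnessLib

/-!
# Coordinates of a soft fcc shell — I: Gram data and the Gram–Schmidt frame
# (route `HullExactificationCascade`, crux `ZeroDefectDensity`, stmt-AtomisticToContinuum-12086; stub `stub_coordsFcc`)

Support file (lead c4, stub-worker) for the registered stub `stub_coordsFcc` of
`Cruxes/ZeroDefectDensity/Lines/birth.lean`: twelve shell vectors `p i` (`i : Fin 12`, labelled by the
fcc table `fccTab` of `Literature/Geometry/DiscreteGeometry/KissingRigidity.lean`) with norms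
`1 ± 1/4000`, contacts `1 ± 1/4000`, square diagonals `|d² - 2| ≤ 38/4000` and `√3`-pairs
`|d² - 3| ≤ 40/4000` are, in a suitable orthonormal frame, within `49/1000` of the pattern.  The frame is
the explicit Gram–Schmidt frame of the toolkit file `…ZeroDefectDensityAsmFrame` applied to
`v₁ = p 0 + p 1 ≈ √2 e_x`, `v₂ = p 0 - p 1 ≈ √2 e_y`, `v₃ = p 4 - p 5 ≈ √2 e_z`
(`fccTab 0, 1, 4, 5 = (1,1,0), (1,-1,0), (1,0,1), (1,0,-1)`).  This file provides

* `scaled_div_bound`, `mul_bounds_of_abs_le` — two interval lemmas (the coordinate `√2 ⟪x, v⟫/‖v‖` of a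
  vector against a frame vector of squared norm `2 ± δ`);
* `inner_self_bound`, `inner_contact_bound`, `inner_sqrt2_bound`, `inner_sqrt3_bound` — the GRAM DATA:
  the metric hypotheses give `|⟪p i, p j⟫ - (fccTab i · fccTab j)/2| ≤ 1/1000` (self, contact) resp.
  `≤ 3/500` (`√2`, `√3` pairs);
* `fcc_frame` — the FRAME NUMBERS: `‖v₁‖², ‖w₂‖², ‖w₃‖² = 2 ± 141/10000`, `|⟪v₂, b₁⟫| ≤ 3/2000`,
  `|⟪v₃, b₁⟫|, |⟪v₃, b₂⟫| ≤ 3/1000`, non-vanishing of `v₁, w₂, w₃`, and `‖b₁‖ = ‖b₂‖ = 1`, `b₁ ⊥ b₂`.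

All constants were checked in exact rational arithmetic; the per-point coordinate bounds are in the
companion files `…CoordsFccGood`, `…CoordsFccBad`, the stub in `…CoordsFcc`. [folklore]
-/

noncomputable section

namespace Summit.AtomisticToContinuum.Crystallization.Theorems.ZeroDefectDensityBirth

open Real RealInnerProductSpace Literature.Geometry.DiscreteGeometry

/-! ### Two interval lemmas -/

/-- Scaled coordinate against a frame vector: if `|g - t| ≤ eₙ`, `|n² - 2| ≤ δ < 2` and `n > 0` then
`|√2 g/n - t| ≤ (eₙ + |t| δ/2)/(1 - δ/2)`. [folklore] -/
theorem scaled_div_bound {g n t en δ : ℝ} (hg : |g - t| ≤ en) (hn : |n ^ 2 - 2| ≤ δ) (hn0 : 0 < n)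
    (hδ : δ < 2) : |Real.sqrt 2 * g / n - t| ≤ (en + |t| * (δ / 2)) / (1 - δ / 2) := by
  have hs : (0 : ℝ) < Real.sqrt 2 := by positivity
  set ρ : ℝ := n / Real.sqrt 2 with hρ
  have hρ0 : 0 ≤ ρ := by positivity
  have hkey : Real.sqrt 2 * g / n = g / ρ := by
    rw [hρ]; field_simp
  have hρ2 : |ρ ^ 2 - 1 ^ 2| ≤ δ / 2 := by
    have : ρ ^ 2 = n ^ 2 / 2 := by
      rw [hρ, div_pow, Real.sq_sqrt (by norm_num : (0:ℝ) ≤ 2)]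
    rw [this, one_pow, show n ^ 2 / 2 - 1 = (n ^ 2 - 2) / 2 by ring, abs_div, abs_two]
    linarith
  have hρ1 : |ρ - 1| ≤ δ / 2 := by
    simpa using abs_sub_le_of_sq hρ0 one_pos hρ2
  rw [hkey]
  simpa using abs_div_sub_div_le hg hρ1 (by linarith) one_pos

/-- Products of bounded quantities, two-sided form: `|a| ≤ A`, `|b| ≤ B` give
`-(A B) ≤ a b ≤ A B`. [folklore] -/
theorem mul_bounds_of_abs_le {a b A B : ℝ} (ha : |a| ≤ A) (hb : |b| ≤ B) :
    -(A * B) ≤ a * b ∧ a * b ≤ A * B := by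
  rw [← abs_le, abs_mul]
  exact mul_le_mul ha hb (abs_nonneg _) ((abs_nonneg _).trans ha)

/-! ### Gram data from the metric hypotheses (`η = 1/4000`) -/

/-- A vector of norm `1 ± 1/4000` has `|‖x‖² - 1| ≤ 8001/16000000`. [folklore] -/
theorem sq_norm_bound {F : Type*} [NormedAddCommGroup F] {x : F}
    (hx : 1 - 1 / 4000 ≤ ‖x‖ ∧ ‖x‖ ≤ 1 + 1 / 4000) :
    |‖x‖ ^ 2 - 1| ≤ 8001 / 16000000 := by
  rw [abs_le]; constructor <;> nlinarith [hx.1, hx.2]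

/-- Self inner products: `|⟪x, x⟫ - 1| ≤ 1/1000`. [folklore] -/
theorem inner_self_bound {F : Type*} [NormedAddCommGroup F] [InnerProductSpace ℝ F] {x : F}
    (hx : 1 - 1 / 4000 ≤ ‖x‖ ∧ ‖x‖ ≤ 1 + 1 / 4000) :
    |⟪x, x⟫ - 1| ≤ 1 / 1000 := by
  rw [real_inner_self_eq_norm_sq]
  exact (sq_norm_bound hx).trans (by norm_num)

/-- Contact pairs: `‖x - y‖ = 1 ± 1/4000` gives `|⟪x, y⟫ - 1/2| ≤ 1/1000`. [folklore] -/
theorem inner_contact_bound {F : Type*} [NormedAddCommGroup F] [InnerProductSpace ℝ F] {x y : F}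
    (hx : 1 - 1 / 4000 ≤ ‖x‖ ∧ ‖x‖ ≤ 1 + 1 / 4000)
    (hy : 1 - 1 / 4000 ≤ ‖y‖ ∧ ‖y‖ ≤ 1 + 1 / 4000)
    (hd : 1 - 1 / 4000 ≤ ‖x - y‖ ∧ ‖x - y‖ ≤ 1 + 1 / 4000) : |⟪x, y⟫ - 1 / 2| ≤ 1 / 1000 := by
  have h1 := abs_le.1 (sq_norm_bound hx)
  have h2 := abs_le.1 (sq_norm_bound hy)
  have h3 := abs_le.1 (sq_norm_bound hd)
  have h := norm_sub_sq_real x y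
  rw [abs_le]; constructor <;> linarith [h1.1, h1.2, h2.1, h2.2, h3.1, h3.2]

/-- Square-diagonal pairs: `|‖x - y‖² - 2| ≤ 38/4000` gives `|⟪x, y⟫| ≤ 3/500`. [folklore] -/
theorem inner_sqrt2_bound {F : Type*} [NormedAddCommGroup F] [InnerProductSpace ℝ F] {x y : F}
    (hx : 1 - 1 / 4000 ≤ ‖x‖ ∧ ‖x‖ ≤ 1 + 1 / 4000)
    (hy : 1 - 1 / 4000 ≤ ‖y‖ ∧ ‖y‖ ≤ 1 + 1 / 4000) (hd : |‖x - y‖ ^ 2 - 2| ≤ 38 / 4000) :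
    |⟪x, y⟫| ≤ 3 / 500 := by
  have h1 := abs_le.1 (sq_norm_bound hx)
  have h2 := abs_le.1 (sq_norm_bound hy)
  have h3 := abs_le.1 hd
  have h := norm_sub_sq_real x y
  rw [abs_le]; constructor <;> linarith [h1.1, h1.2, h2.1, h2.2, h3.1, h3.2]

/-- `√3`-pairs: `|‖x - y‖² - 3| ≤ 40/4000` gives `|⟪x, y⟫ + 1/2| ≤ 3/500`. [folklore] -/
theorem inner_sqrt3_bound {F : Type*} [NormedAddCommGroup F] [InnerProductSpace ℝ F] {x y : F}
    (hx : 1 - 1 / 4000 ≤ ‖x‖ ∧ ‖x‖ ≤ 1 + 1 / 4000)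
    (hy : 1 - 1 / 4000 ≤ ‖y‖ ∧ ‖y‖ ≤ 1 + 1 / 4000) (hd : |‖x - y‖ ^ 2 - 3| ≤ 40 / 4000) :
    |⟪x, y⟫ + 1 / 2| ≤ 3 / 500 := by
  have h1 := abs_le.1 (sq_norm_bound hx)
  have h2 := abs_le.1 (sq_norm_bound hy)
  have h3 := abs_le.1 hd
  have h := norm_sub_sq_real x y
  rw [abs_le]; constructor <;> linarith [h1.1, h1.2, h2.1, h2.2, h3.1, h3.2]

/-- A vector with `|‖v‖² - 2| ≤ 141/10000` has `‖v‖ ≥ 7/5`, in particular `v ≠ 0`. [folklore] -/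
theorem norm_ge_of_sq_near_two {F : Type*} [NormedAddCommGroup F] {v : F}
    (h : |‖v‖ ^ 2 - 2| ≤ 141 / 10000) :
    7 / 5 ≤ ‖v‖ ∧ 0 < ‖v‖ ∧ v ≠ 0 := by
  have h1 := (abs_le.1 h).1
  have hge : 7 / 5 ≤ ‖v‖ := by
    by_contra hlt
    push Not at hlt
    nlinarith [norm_nonneg v]
  have hpos : 0 < ‖v‖ := by linarith
  exact ⟨hge, hpos, norm_pos_iff.1 hpos⟩

/-! ### The frame numbers of the fcc Gram–Schmidt frame -/

/-- **Frame numbers.**  For twelve vectors with the fcc Gram data, the Gram–Schmidt frame on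
`v₁ = p 0 + p 1`, `v₂ = p 0 - p 1`, `v₃ = p 4 - p 5` (`b₁ = v₁/‖v₁‖`, `w₂ = v₂ - ⟪v₂,b₁⟫ b₁`,
`b₂ = w₂/‖w₂‖`, `w₃ = v₃ - ⟪v₃,b₁⟫ b₁ - ⟪v₃,b₂⟫ b₂`) has `‖v₁‖², ‖w₂‖², ‖w₃‖² = 2 ± 141/10000`,
`|⟪v₂,b₁⟫| ≤ 3/2000`, `|⟪v₃,b₁⟫|, |⟪v₃,b₂⟫| ≤ 3/1000`; `v₁, w₂, w₃ ≠ 0`; `b₁, b₂` orthonormal. [folklore] -/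
theorem fcc_frame (p : Fin 12 → EuclideanSpace ℝ (Fin 3)) (b₁ b₂ : EuclideanSpace ℝ (Fin 3))
    (hG0 : ∀ i, |⟪p i, p i⟫ - 1| ≤ 1 / 1000)
    (hG1 : ∀ i j, fccAdj i j → |⟪p i, p j⟫ - 1 / 2| ≤ 1 / 1000)
    (hG2 : ∀ i j, sqNormInt (fccTab i - fccTab j) = 4 → |⟪p i, p j⟫| ≤ 3 / 500)
    (hb₁ : b₁ = ‖p 0 + p 1‖⁻¹ • (p 0 + p 1))
    (hb₂ : b₂ = ‖(p 0 - p 1) - ⟪p 0 - p 1, b₁⟫ • b₁‖⁻¹ • ((p 0 - p 1) - ⟪p 0 - p 1, b₁⟫ • b₁)) :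
    (p 0 + p 1 ≠ 0 ∧ 0 < ‖p 0 + p 1‖ ∧ |‖p 0 + p 1‖ ^ 2 - 2| ≤ 141 / 10000) ∧
    |⟪p 0 - p 1, b₁⟫| ≤ 3 / 2000 ∧
    ((p 0 - p 1) - ⟪p 0 - p 1, b₁⟫ • b₁ ≠ 0 ∧ 0 < ‖(p 0 - p 1) - ⟪p 0 - p 1, b₁⟫ • b₁‖ ∧
      |‖(p 0 - p 1) - ⟪p 0 - p 1, b₁⟫ • b₁‖ ^ 2 - 2| ≤ 141 / 10000) ∧
    |⟪p 4 - p 5, b₁⟫| ≤ 3 / 1000 ∧ |⟪p 4 - p 5, b₂⟫| ≤ 3 / 1000 ∧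
    ((p 4 - p 5) - ⟪p 4 - p 5, b₁⟫ • b₁ - ⟪p 4 - p 5, b₂⟫ • b₂ ≠ 0 ∧
      0 < ‖(p 4 - p 5) - ⟪p 4 - p 5, b₁⟫ • b₁ - ⟪p 4 - p 5, b₂⟫ • b₂‖ ∧
      |‖(p 4 - p 5) - ⟪p 4 - p 5, b₁⟫ • b₁ - ⟪p 4 - p 5, b₂⟫ • b₂‖ ^ 2 - 2| ≤ 141 / 10000) ∧
    (‖b₁‖ = 1 ∧ ‖b₂‖ = 1 ∧ ⟪b₁, b₂⟫ = 0) := by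
  -- the Gram entries used
  have g00 := abs_le.1 (hG0 0)
  have g11 := abs_le.1 (hG0 1)
  have g44 := abs_le.1 (hG0 4)
  have g55 := abs_le.1 (hG0 5)
  have g01 := abs_le.1 (hG2 0 1 (by decide))
  have g45 := abs_le.1 (hG2 4 5 (by decide))
  have g40 := abs_le.1 (hG1 4 0 (by decide))
  have g41 := abs_le.1 (hG1 4 1 (by decide))
  have g50 := abs_le.1 (hG1 5 0 (by decide))
  have g51 := abs_le.1 (hG1 5 1 (by decide))
  -- `v₁`
  have hn1sq : ‖p 0 + p 1‖ ^ 2 = ⟪p 0, p 0⟫ + ⟪p 1, p 1⟫ + 2 * ⟪p 0, p 1⟫ := by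
    rw [@norm_add_sq_real, real_inner_self_eq_norm_sq, real_inner_self_eq_norm_sq]; ring
  have hn1 : |‖p 0 + p 1‖ ^ 2 - 2| ≤ 141 / 10000 := by
    rw [hn1sq, abs_le]
    constructor <;> linarith [g00.1, g00.2, g11.1, g11.2, g01.1, g01.2]
  obtain ⟨hn1ge, hn1pos, hv1⟩ := norm_ge_of_sq_near_two hn1
  have nb1 : ‖b₁‖ = 1 := by
    rw [hb₁, norm_smul, norm_inv, norm_norm, inv_mul_cancel₀ hn1pos.ne']
  -- `⟪v₂, b₁⟫`
  have hs21 : ⟪p 0 - p 1, b₁⟫ = (⟪p 0, p 0⟫ - ⟪p 1, p 1⟫) / ‖p 0 + p 1‖ := by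
    rw [hb₁, inner_gs₁, inner_sub_left, inner_add_right, inner_add_right, real_inner_comm (p 0) (p 1)]
    ring
  have hs21b : |⟪p 0 - p 1, b₁⟫| ≤ 3 / 2000 := by
    rw [hs21, abs_div, abs_of_pos hn1pos, div_le_iff₀ hn1pos]
    have : |⟪p 0, p 0⟫ - ⟪p 1, p 1⟫| ≤ 2 / 1000 := by
      rw [abs_le]; constructor <;> linarith [g00.1, g00.2, g11.1, g11.2]
    linarith
  -- `w₂`
  have hn2sq : ‖(p 0 - p 1) - ⟪p 0 - p 1, b₁⟫ • b₁‖ ^ 2 =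
      ⟪p 0, p 0⟫ + ⟪p 1, p 1⟫ - 2 * ⟪p 0, p 1⟫ - ⟪p 0 - p 1, b₁⟫ ^ 2 := by
    rw [norm_sq_residual nb1, @norm_sub_sq_real, real_inner_self_eq_norm_sq,
      real_inner_self_eq_norm_sq]; ring
  have hn2 : |‖(p 0 - p 1) - ⟪p 0 - p 1, b₁⟫ • b₁‖ ^ 2 - 2| ≤ 141 / 10000 := by
    have hsq : ⟪p 0 - p 1, b₁⟫ ^ 2 ≤ (3 / 2000) ^ 2 := by
      rw [← sq_abs]; exact pow_le_pow_left₀ (abs_nonneg _) hs21b 2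
    have hsq0 := sq_nonneg ⟪p 0 - p 1, b₁⟫
    rw [hn2sq, abs_le]
    constructor <;> linarith [g00.1, g00.2, g11.1, g11.2, g01.1, g01.2]
  obtain ⟨hn2ge, hn2pos, hw2⟩ := norm_ge_of_sq_near_two hn2
  have nb2 : ‖b₂‖ = 1 := by
    rw [hb₂, norm_smul, norm_inv, norm_norm, inv_mul_cancel₀ hn2pos.ne']
  have o12 : ⟪b₁, b₂⟫ = 0 := by
    rw [hb₂, real_inner_smul_right, real_inner_comm ((p 0 - p 1) - ⟪p 0 - p 1, b₁⟫ • b₁) b₁,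
      inner_residual_eq_zero nb1, mul_zero]
  -- `⟪v₃, b₁⟫`
  have hs31 : ⟪p 4 - p 5, b₁⟫ =
      (⟪p 4, p 0⟫ + ⟪p 4, p 1⟫ - ⟪p 5, p 0⟫ - ⟪p 5, p 1⟫) / ‖p 0 + p 1‖ := by
    rw [hb₁, inner_gs₁, inner_sub_left, inner_add_right, inner_add_right]; ring
  have hs31b : |⟪p 4 - p 5, b₁⟫| ≤ 3 / 1000 := by
    rw [hs31, abs_div, abs_of_pos hn1pos, div_le_iff₀ hn1pos]
    have : |⟪p 4, p 0⟫ + ⟪p 4, p 1⟫ - ⟪p 5, p 0⟫ - ⟪p 5, p 1⟫| ≤ 4 / 1000 := by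
      rw [abs_le]
      constructor <;> linarith [g40.1, g40.2, g41.1, g41.2, g50.1, g50.2, g51.1, g51.2]
    linarith
  -- `⟪v₃, b₂⟫`
  have hs32 : ⟪p 4 - p 5, b₂⟫ = (⟪p 4, p 0⟫ - ⟪p 4, p 1⟫ - ⟪p 5, p 0⟫ + ⟪p 5, p 1⟫ -
      ⟪p 0 - p 1, b₁⟫ * ⟪p 4 - p 5, b₁⟫) / ‖(p 0 - p 1) - ⟪p 0 - p 1, b₁⟫ • b₁‖ := by
    rw [hb₂, inner_gs_residual, inner_sub_left, inner_sub_right, inner_sub_right]; ring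
  have hs32b : |⟪p 4 - p 5, b₂⟫| ≤ 3 / 1000 := by
    rw [hs32, abs_div, abs_of_pos hn2pos, div_le_iff₀ hn2pos]
    have hm := mul_bounds_of_abs_le hs21b hs31b
    have : |⟪p 4, p 0⟫ - ⟪p 4, p 1⟫ - ⟪p 5, p 0⟫ + ⟪p 5, p 1⟫ -
        ⟪p 0 - p 1, b₁⟫ * ⟪p 4 - p 5, b₁⟫| ≤ 41 / 10000 := by
      rw [abs_le]
      constructor <;> linarith [g40.1, g40.2, g41.1, g41.2, g50.1, g50.2, g51.1, g51.2, hm.1, hm.2]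
    linarith
  -- `w₃`
  have hn3sq : ‖(p 4 - p 5) - ⟪p 4 - p 5, b₁⟫ • b₁ - ⟪p 4 - p 5, b₂⟫ • b₂‖ ^ 2 =
      ⟪p 4, p 4⟫ + ⟪p 5, p 5⟫ - 2 * ⟪p 4, p 5⟫ - ⟪p 4 - p 5, b₁⟫ ^ 2 - ⟪p 4 - p 5, b₂⟫ ^ 2 := by
    rw [norm_sq_residual₂ nb1 nb2 o12, @norm_sub_sq_real, real_inner_self_eq_norm_sq,
      real_inner_self_eq_norm_sq]; ring
  have hn3 : |‖(p 4 - p 5) - ⟪p 4 - p 5, b₁⟫ • b₁ - ⟪p 4 - p 5, b₂⟫ • b₂‖ ^ 2 - 2| ≤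
      141 / 10000 := by
    have hsq : ⟪p 4 - p 5, b₁⟫ ^ 2 ≤ (3 / 1000) ^ 2 := by
      rw [← sq_abs]; exact pow_le_pow_left₀ (abs_nonneg _) hs31b 2
    have hsq' : ⟪p 4 - p 5, b₂⟫ ^ 2 ≤ (3 / 1000) ^ 2 := by
      rw [← sq_abs]; exact pow_le_pow_left₀ (abs_nonneg _) hs32b 2
    have hsq0 := sq_nonneg ⟪p 4 - p 5, b₁⟫
    have hsq0' := sq_nonneg ⟪p 4 - p 5, b₂⟫
    rw [hn3sq, abs_le]
    constructor <;> linarith [g44.1, g44.2, g55.1, g55.2, g45.1, g45.2]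
  obtain ⟨-, hn3pos, hw3⟩ := norm_ge_of_sq_near_two hn3
  exact ⟨⟨hv1, hn1pos, hn1⟩, hs21b, ⟨hw2, hn2pos, hn2⟩, hs31b, hs32b, ⟨hw3, hn3pos, hn3⟩,
    ⟨nb1, nb2, o12⟩⟩

/-! ### Registered sub-goal (one line, fully qualified) -/

/-- **Registered sub-goal `fcc_frame_bounds`** (helper of `stub_coordsFcc`, lead c4): the frame numbers,
verbatim the registered one-line signature (`= fcc_frame`). [folklore] -/
theorem fcc_frame_bounds : ∀ (p : Fin 12 → EuclideanSpace ℝ (Fin 3)) (b₁ b₂ : EuclideanSpace ℝ (Fin 3)), (∀ i, |inner ℝ (p i) (p i) - 1| ≤ 1 / 1000) → (∀ i j, Literature.Geometry.DiscreteGeometry.fccAdj i j → |inner ℝ (p i) (p j) - 1 / 2| ≤ 1 / 1000) → (∀ i j, Literature.Geometry.DiscreteGeometry.sqNormInt (Literature.Geometry.DiscreteGeometry.fccTab i - Literature.Geometry.DiscreteGeometry.fccTab j) = 4 → |inner ℝ (p i) (p j)| ≤ 3 / 500) → (b₁ = ‖p 0 + p 1‖⁻¹ • (p 0 + p 1)) →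 (b₂ = ‖(p 0 - p 1) - inner ℝ (p 0 - p 1) (b₁) • b₁‖⁻¹ • ((p 0 - p 1) - inner ℝ (p 0 - p 1) (b₁) • b₁)) → (p 0 + p 1 ≠ 0 ∧ 0 < ‖p 0 + p 1‖ ∧ |‖p 0 + p 1‖ ^ 2 - 2| ≤ 141 / 10000) ∧ |inner ℝ (p 0 - p 1) (b₁)| ≤ 3 / 2000 ∧ ((p 0 - p 1) - inner ℝ (p 0 - p 1) (b₁) • b₁ ≠ 0 ∧ 0 < ‖(p 0 - p 1) - inner ℝ (p 0 - p 1) (b₁) • b₁‖ ∧ |‖(p 0 - p 1) - inner ℝ (p 0 - p 1) (b₁) • b₁‖ ^ 2 - 2| ≤ 141 / 10000) ∧ |inner ℝ (p 4 - p 5) (b₁)| ≤ 3 / 1000 ∧ |inner ℝ (p 4 - p 5) (b₂)| ≤ 3 / 1000 ∧ ((p 4 - p 5) - inner ℝ (p 4 - p 5) (b₁) • b₁ - inner ℝ (p 4 - p 5) (b₂) • b₂ ≠ 0 ∧ 0 < ‖(p 4 - p 5) - inner ℝ (p 4 - p 5) (b₁) • b₁ - inner ℝ (p 4 - p 5) (b₂)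 • b₂‖ ∧ |‖(p 4 - p 5) - inner ℝ (p 4 - p 5) (b₁) • b₁ - inner ℝ (p 4 - p 5) (b₂) • b₂‖ ^ 2 - 2| ≤ 141 / 10000) ∧ (‖b₁‖ = 1 ∧ ‖b₂‖ = 1 ∧ inner ℝ (b₁) (b₂) = 0) :=
  fcc_frame

end Summit.AtomisticToContinuum.Crystallization.Theorems.ZeroDefectDensityBirth

end
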